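import Mathlib
import Literature.LinearAlgebra.Matrix.CrossInterpolation
import Literature.LinearAlgebra.Matrix.SchurComplementQuotient
import Literature.LinearAlgebra.Matrix.MaximalVolumePivot

/-!
# Error bounds for cross interpolation on a maximal-volume pivot block

The *maximal-volume principle* for cross (skeleton, CUR) interpolation `Ã = A[:, c] P⁻¹ A[r, :]`
(`Literature.LinearAlgebra.Matrix.crossInterp`, pivot block `P = A[r, c]`): if `|det P|` is
maximal among the `k × k` submatrices of `A`, the interpolation error `A - Ã` is controlled by
the best possible error.  This file formalises the determinant (SVD-free) part of the theory of
Goreinov–Tyrtyshnikov and the Chebyshev-norm quasi-optimality theorem: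

* `det_submatrix_vecCons_vecCons` — the `(k+1) × (k+1)` submatrix `Â = A[(i, r), (j, c)]` (the
  pivot block bordered by one row and one column of `A`) has `det Â = det P · (A - Ã) i j`
  [HornJohnson2013, §0.8.5 (0.8.5.4)]; in [GoreinovTyrtyshnikov2001, proof of Thm 2.1] this is
  the step `|det Â| / |det A₁₁| = |γ|`, `γ = a - cᵀ A₁₁⁻¹ b`;
* `mul_abs_adjugate_submatrix_vecCons_vecCons_le`,
  `mul_abs_inv_submatrix_vecCons_vecCons_mul_abs_le_one`,
  `inv_submatrix_vecCons_vecCons_apply_zero_zero` — every cofactor of `Â` is a `k × k` minor of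
  `A`, hence at most `|det P|` under maximal volume, so that `‖Â⁻¹‖_C = |γ⁻¹|` (the corner entry
  of `Â⁻¹` being exactly `γ⁻¹`) [GoreinovTyrtyshnikov2001, proof of Thm 2.1]; stated with the
  relaxation factor `ν` of [GoreinovTyrtyshnikov2001, Thm 2.2] (`|det P| ≥ ν ·` maximal volume);
* `abs_sub_crossInterp_le_of_pivotCols_volume_maximal` — [GoreinovTyrtyshnikov2001, Thm 1.1]:
  interpolation of `f` by `span{u₁, …, u_k}` on nodes of maximal volume is quasi-optimal in the
  sup norm, `E_int ≤ (k+1) E_best` (finite node set; rows of `A` as the functions);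
* `abs_sub_crossInterp_le_of_volume_maximal` (and the `Fin`-indexed, `ν`-relaxed
  `abs_sub_crossInterp_le_of_volume_submaximal_fin`) — QUASI-OPTIMALITY IN THE CHEBYSHEV NORM:
  `‖A - Ã‖_C ≤ (r+1)² min_{rank F ≤ r} ‖A - F‖_C` for a maximal-volume `r × r` pivot block
  [GoreinovTyrtyshnikov2011], as reported in [Savostyanov2014, §2 eq. (6)], stated entrywise
  (`|A i j - F i j| ≤ δ` for all `i, j` implies `|(A - Ã) i j| ≤ (r+1)² δ`).

The proof of the Chebyshev bound formalised here is an elementary determinant argument (a kernel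
vector `x` of the bordered block of `F` satisfies `x = Â⁻¹ (Â - F̂) x`, and `‖Â⁻¹‖_C ≤ |γ|⁻¹`);
it is not claimed to follow the argument of [GoreinovTyrtyshnikov2011].  NOT formalised: the
singular-value bounds `‖A - Ã‖_C ≤ (k+1) σ_{k+1}(A)` and `≤ ν⁻¹ (k+1) σ_{k+1}(A)` of
[GoreinovTyrtyshnikov2001, Thm 2.1, Thm 2.2, Cor. 2.3] themselves (their remaining ingredient,
the interlacing `σ_{k+1}(A)⁻¹ ≤ σ_{k+1}(Â)⁻¹ ≤ (k+1) ‖Â⁻¹‖_C`, needs singular values, which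
Mathlib does not have), the `r^{r/2}`-type comparisons of dominant versus maximal-volume blocks,
and all search algorithms (`maxvol`).

References: S. A. Goreinov, E. E. Tyrtyshnikov, *The maximal-volume concept in approximation by
low-rank matrices*, Contemp. Math. 280 (2001) 47–51, Theorems 1.1, 2.1, 2.2, Corollary 2.3;
S. A. Goreinov, E. E. Tyrtyshnikov, *Quasioptimality of skeleton approximation of a matrix in
the Chebyshev norm*, Dokl. Math. 83 (2011) 374–375; D. V. Savostyanov, *Quasioptimality of
maximum-volume cross interpolation of tensors*, Linear Algebra Appl. 458 (2014) 217–244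
(arXiv:1305.1818), §2 eq. (6); R. A. Horn, C. R. Johnson, *Matrix Analysis*, 2nd ed., CUP 2013,
§0.8.5.
AI-produced formalisation (H21 engines group, seat eng-quad-2, 2026-08-21); no facts, no axioms
beyond Mathlib's, no `sorry`.
-/

open Matrix

namespace Literature.LinearAlgebra.Matrix

/-! ## The error as a Schur complement; re-indexing the pivots -/

section CommRing

variable {K : Type*} [CommRing K] {m n ι : Type*} [Fintype ι] [DecidableEq ι] {k : ℕ}

/-- [cite: NunezFernandezEtAl2025, §3.2.3] THE ERROR OF THE CROSS INTERPOLATION IS THE SCHUR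
COMPLEMENT of the pivot block `P = A[r, c]` in `A` (all rows and columns kept; the general-position
form of `fromBlocks_sub_crossInterp`): `A - Ã = [A/P] = A - A[:, c] P⁻¹ A[r, :]` — the unfolding
lemma joining `crossInterp` and `schurCompl`. -/
theorem sub_crossInterp_eq_schurCompl (A : Matrix m n K) (r : ι → m) (c : ι → n) :
    A - crossInterp A r c =
      schurCompl (A.submatrix r c) (A.submatrix r id) (A.submatrix id c) A := rfl

/-- [cite: NunezFernandezEtAl2025, §3.2.2] PERMUTATION INVARIANCE: re-indexing the pivot list
along an equivalence (in particular permuting the pivots) does not change the cross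
interpolation `Ã = A[:, c] P⁻¹ A[r, :]`. -/
theorem crossInterp_comp_equiv {ι' : Type*} [Fintype ι'] [DecidableEq ι'] (A : Matrix m n K)
    (r : ι → m) (c : ι → n) (e : ι' ≃ ι) :
    crossInterp A (r ∘ e) (c ∘ e) = crossInterp A r c := by
  rw [crossInterp_def, crossInterp_def,
    show A.submatrix id (c ∘ ⇑e) = (A.submatrix id c).submatrix id e from rfl,
    show A.submatrix (r ∘ ⇑e) (c ∘ ⇑e) = (A.submatrix r c).submatrix e e from rfl,
    show A.submatrix (r ∘ ⇑e) id = (A.submatrix r id).submatrix e id from rfl,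
    inv_submatrix_equiv, submatrix_mul_equiv, submatrix_mul_equiv, submatrix_id_id]

/-- [folklore] Cramer / adjugate form of an entry of the nonsingular inverse:
`M⁻¹ p q · det M = adj M p q`. -/
private theorem inv_apply_mul_det {o : Type*} [Fintype o] [DecidableEq o] (M : Matrix o o K)
    (hM : IsUnit M.det) (p q : o) : M⁻¹ p q * M.det = adjugate M p q := by
  rw [inv_def, Matrix.smul_apply, smul_eq_mul, mul_assoc, mul_comm (adjugate M p q), ← mul_assoc,
    Ring.inverse_mul_cancel _ hM, one_mul]

/-! ## The bordered pivot block `Â = A[(i, r), (j, c)]` -/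

/-- [cite: HornJohnson2013, §0.8.5 (0.8.5.4)]; [cite: GoreinovTyrtyshnikov2001, Thm 2.1 (proof)]
THE ERROR ENTRY IS A RATIO OF MINORS: for a nonsingular pivot block `P = A[r, c]`
(`r, c : Fin k → _`), the `(k+1) × (k+1)` submatrix `Â = A[(i, r), (j, c)]` of `A` — `P`
bordered by row `i` and column `j` — has `det Â = det P · (A - Ã) i j`, `Ã = crossInterp A r c`.
In the notation of the proof of [GoreinovTyrtyshnikov2001, Thm 2.1]: `|det Â| / |det A₁₁| = |γ|`
with `γ = a - cᵀ A₁₁⁻¹ b`. -/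
theorem det_submatrix_vecCons_vecCons (A : Matrix m n K) (r : Fin k → m) (c : Fin k → n)
    (hP : IsUnit (A.submatrix r c).det) (i : m) (j : n) :
    (A.submatrix (vecCons i r) (vecCons j c)).det =
      (A.submatrix r c).det * (A - crossInterp A r c) i j := by
  let e : Fin (k + 1) ≃ Fin k ⊕ Unit := (finSuccEquiv k).trans (Equiv.optionEquivSumPUnit (Fin k))
  have hB : A.submatrix (vecCons i r) (vecCons j c) =
      (fromBlocks (A.submatrix r c) (A.submatrix r fun _ : Unit => j)
        (A.submatrix (fun _ : Unit => i) c)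
        (A.submatrix (fun _ : Unit => i) fun _ : Unit => j)).submatrix e e := by
    ext p q
    induction p using Fin.cases <;> induction q using Fin.cases <;> simp [e, fromBlocks]
  have hE : (A - crossInterp A r c) i j * (A.submatrix r c).det =
      (fromBlocks (A.submatrix r c) (A.submatrix r fun _ : Unit => j)
        (A.submatrix (fun _ : Unit => i) c)
        (A.submatrix (fun _ : Unit => i) fun _ : Unit => j)).det := by
    rw [sub_crossInterp_eq_schurCompl, schurCompl_apply_mul_det _ _ _ _ hP]
    simp only [submatrix_submatrix, Function.comp_id, Function.id_comp]
  rw [hB, det_submatrix_equiv_self, ← hE, mul_comm]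

/-- [cite: GoreinovTyrtyshnikov2001, Thm 2.1 (proof)] Deleting the bordering row and column
from `Â = A[(i, r), (j, c)]` recovers the pivot block, so the corner cofactor of `Â` is
`det P`. -/
theorem adjugate_submatrix_vecCons_vecCons_zero_zero (A : Matrix m n K) (r : Fin k → m)
    (c : Fin k → n) (i : m) (j : n) :
    adjugate (A.submatrix (vecCons i r) (vecCons j c)) 0 0 = (A.submatrix r c).det := by
  rw [adjugate_fin_succ_eq_det_submatrix, submatrix_submatrix]
  have h : (vecCons i r ∘ (0 : Fin (k + 1)).succAbove) = r := by
    funext s; simp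
  have h' : (vecCons j c ∘ (0 : Fin (k + 1)).succAbove) = c := by
    funext s; simp
  rw [h, h']
  simp

end CommRing

/-! ## Maximal volume: the inverse of the bordered block is controlled by the error entry -/

section Ordered

variable {K : Type*} [CommRing K] [LinearOrder K] [IsStrictOrderedRing K]
variable {m n ι : Type*} [Fintype ι] [DecidableEq ι] {k : ℕ}

/-- [cite: GoreinovTyrtyshnikov2001, Thm 2.1 (proof)]; [cite: GoreinovTyrtyshnikov2001, Thm 2.2]
EVERY COFACTOR OF THE BORDERED BLOCK IS A `k × k` MINOR OF `A`: if `ν |det A[r', c']| ≤ |det P|`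
for all `k × k` submatrices `A[r', c']` of `A` (`ν = 1`: `P = A[r, c]` has maximal volume;
`0 < ν < 1`: the relaxed hypothesis `ν^{-1} |det A₁₁| ≥ |det M|` of
[GoreinovTyrtyshnikov2001, Thm 2.2]), then every entry of `adj Â`, `Â = A[(i, r), (j, c)]`,
satisfies `ν |adj Â p q| ≤ |det P|` — the maximal-volume step of the proof of
[GoreinovTyrtyshnikov2001, Thm 2.1]. -/
theorem mul_abs_adjugate_submatrix_vecCons_vecCons_le (A : Matrix m n K) (r : Fin k → m)
    (c : Fin k → n) {ν : K}
    (hmax : ∀ (r' : Fin k → m) (c' : Fin k → n),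
      ν * |(A.submatrix r' c').det| ≤ |(A.submatrix r c).det|)
    (i : m) (j : n) (p q : Fin (k + 1)) :
    ν * |adjugate (A.submatrix (vecCons i r) (vecCons j c)) p q| ≤ |(A.submatrix r c).det| := by
  rw [adjugate_fin_succ_eq_det_submatrix, abs_mul, abs_pow, abs_neg, abs_one, one_pow, one_mul,
    submatrix_submatrix]
  exact hmax _ _

/-- [cite: GoreinovTyrtyshnikov2001, Thm 2.1 (proof)]; [cite: GoreinovTyrtyshnikov2001, Thm 2.2]
THE INVERSE OF THE BORDERED BLOCK IS BOUNDED BY THE INVERSE ERROR — the identity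
`‖Â⁻¹‖_C = |γ⁻¹|` of the proof of [GoreinovTyrtyshnikov2001, Thm 2.1], as an inequality and with
the relaxation factor `ν` of [GoreinovTyrtyshnikov2001, Thm 2.2]: if `P = A[r, c]` is nonsingular
and `ν |det A[r', c']| ≤ |det P|` for all `k × k` submatrices of `A`, then every entry
of `Â⁻¹`, `Â = A[(i, r), (j, c)]`, satisfies `ν · |Â⁻¹ p q| · |(A - Ã) i j| ≤ 1`.  (If `Â` is
singular, `Â⁻¹ = 0` by Mathlib's convention and the bound is trivial.) -/
theorem mul_abs_inv_submatrix_vecCons_vecCons_mul_abs_le_one (A : Matrix m n K) (r : Fin k → m)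
    (c : Fin k → n) (hP : IsUnit (A.submatrix r c).det) {ν : K}
    (hmax : ∀ (r' : Fin k → m) (c' : Fin k → n),
      ν * |(A.submatrix r' c').det| ≤ |(A.submatrix r c).det|)
    (i : m) (j : n) (p q : Fin (k + 1)) :
    ν * |(A.submatrix (vecCons i r) (vecCons j c))⁻¹ p q| * |(A - crossInterp A r c) i j| ≤ 1 := by
  by_cases hB : IsUnit (A.submatrix (vecCons i r) (vecCons j c)).det
  · have hdetP : 0 < |(A.submatrix r c).det| := abs_pos.mpr hP.ne_zero
    refine le_of_mul_le_mul_right ?_ hdetP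
    calc ν * |(A.submatrix (vecCons i r) (vecCons j c))⁻¹ p q| * |(A - crossInterp A r c) i j| *
          |(A.submatrix r c).det|
        = ν * |(A.submatrix (vecCons i r) (vecCons j c))⁻¹ p q *
            (A.submatrix (vecCons i r) (vecCons j c)).det| := by
          rw [det_submatrix_vecCons_vecCons A r c hP i j, abs_mul, abs_mul]; ring
      _ = ν * |adjugate (A.submatrix (vecCons i r) (vecCons j c)) p q| := by
          rw [inv_apply_mul_det _ hB]
      _ ≤ |(A.submatrix r c).det| := mul_abs_adjugate_submatrix_vecCons_vecCons_le A r c hmax i j p q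
      _ = 1 * |(A.submatrix r c).det| := (one_mul _).symm
  · rw [nonsing_inv_apply_not_isUnit _ hB]
    simp

/-! ## Interpolation on maximal-volume nodes (GT2001, Theorem 1.1) -/

/-- [cite: GoreinovTyrtyshnikov2001, Thm 1.1] INTERPOLATION ON NODES OF MAXIMAL VOLUME IS
QUASI-OPTIMAL, `E_int ≤ (k+1) E_best` — the finite form (node set `V` = the column index type
`n`; basis functions `u₁, …, u_k` = the pivot rows `A (r s)`; `f` = row `i` of `A`; nodes
`x_t` = pivot columns `c t`; `M = [u_s(x_t)] = A[r, c]`; the interpolant `Σ αᵢ uᵢ` matching `f`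
at the nodes is row `i` of `Ã = crossInterp A r c`).  If `M` is nonsingular and its volume
`|det M|` cannot be increased by moving ONE node (a fortiori if the nodes maximise the volume
among all choices from `V`, the hypothesis of [GoreinovTyrtyshnikov2001, Thm 1.1]), then for
every competitor `u = Σ α_s u_s` with `‖f - u‖_{C(V)} ≤ δ` the interpolation error satisfies
`|(A - Ã) i j| ≤ (k+1) δ`; taking the infimum over `u` gives `E_int(f) ≤ (k+1) E_best(f)`.
Proof as in the source: Cramer's rule and the dominance `|det Mᵢ / det M| ≤ 1`
(`abs_inv_submatrix_mul_le_one_of_volume_maximal`). -/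
theorem abs_sub_crossInterp_le_of_pivotCols_volume_maximal (A : Matrix m n K) (r : ι → m)
    (c : ι → n) (hP : IsUnit (A.submatrix r c).det)
    (hmax : ∀ (s : ι) (j' : n),
      |(A.submatrix r (Function.update c s j')).det| ≤ |(A.submatrix r c).det|)
    (i : m) (α : ι → K) {δ : K} (hα : ∀ t, |A i t - (α ᵥ* A.submatrix r id) t| ≤ δ) (j : n) :
    |(A - crossInterp A r c) i j| ≤ (Fintype.card ι + 1) * δ := by
  -- the coefficient vector of the interpolant: row `i` of `A[:, c] P⁻¹`
  have hci : crossInterp A r c i j =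
      ((fun t => (A.submatrix id c * (A.submatrix r c)⁻¹) i t) ᵥ* A.submatrix r id) j := by
    simp [crossInterp, Matrix.mul_apply, vecMul, dotProduct]
  -- values at the nodes
  have hαP : α ᵥ* A.submatrix r c = fun t => (α ᵥ* A.submatrix r id) (c t) := by
    ext t; simp [vecMul, dotProduct]
  have hβP : (fun t => (A.submatrix id c * (A.submatrix r c)⁻¹) i t) ᵥ* A.submatrix r c =
      fun t => A i (c t) := by
    ext t
    have h := congr_fun (congr_fun (nonsing_inv_mul_cancel_right _ (A.submatrix id c) hP) i) t
    rw [Matrix.mul_apply] at h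
    simpa [vecMul, dotProduct] using h
  -- the difference of the coefficient vectors is `ρ P⁻¹`, `ρ` the residual of `α` at the nodes
  have hαβ : α - (fun t => (A.submatrix id c * (A.submatrix r c)⁻¹) i t) =
      (fun t => (α ᵥ* A.submatrix r id) (c t) - A i (c t)) ᵥ* (A.submatrix r c)⁻¹ := by
    have h1 : (α - fun t => (A.submatrix id c * (A.submatrix r c)⁻¹) i t) ᵥ* A.submatrix r c =
        fun t => (α ᵥ* A.submatrix r id) (c t) - A i (c t) := by
      rw [sub_vecMul, hαP, hβP]; rfl
    rw [← h1, vecMul_vecMul, mul_nonsing_inv _ hP, vecMul_one]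
  -- dominance of the maximal-volume block among the pivot rows
  have hdom : ∀ t, |((A.submatrix r c)⁻¹ * A.submatrix r id) t j| ≤ 1 := fun t => by
    have h := abs_inv_submatrix_mul_le_one_of_volume_maximal (A.submatrix r id) c
      (by simpa using hP) (fun s j' => by simpa using hmax s j') t j
    simpa using h
  -- error decomposition `f - u_int = (f - u) + (α - β) R`, `(α - β) R = ρ (P⁻¹ R)`
  have hE : (A - crossInterp A r c) i j = (A i j - (α ᵥ* A.submatrix r id) j) +
      ∑ t, ((α ᵥ* A.submatrix r id) (c t) - A i (c t)) *
        ((A.submatrix r c)⁻¹ * A.submatrix r id) t j := by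
    have h2 : ((α - fun t => (A.submatrix id c * (A.submatrix r c)⁻¹) i t) ᵥ* A.submatrix r id) j =
        ∑ t, ((α ᵥ* A.submatrix r id) (c t) - A i (c t)) *
          ((A.submatrix r c)⁻¹ * A.submatrix r id) t j := by
      rw [hαβ, vecMul_vecMul]; simp [vecMul, dotProduct]
    rw [Matrix.sub_apply, hci, ← h2, sub_vecMul, Pi.sub_apply]; ring
  have hδ0 : 0 ≤ δ := (abs_nonneg _).trans (hα j)
  rw [hE]
  calc |A i j - (α ᵥ* A.submatrix r id) j +
        ∑ t, ((α ᵥ* A.submatrix r id) (c t) - A i (c t)) *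
          ((A.submatrix r c)⁻¹ * A.submatrix r id) t j|
      ≤ |A i j - (α ᵥ* A.submatrix r id) j| +
        ∑ t, |((α ᵥ* A.submatrix r id) (c t) - A i (c t)) *
          ((A.submatrix r c)⁻¹ * A.submatrix r id) t j| :=
        (abs_add_le _ _).trans (add_le_add le_rfl (Finset.abs_sum_le_sum_abs _ _))
    _ ≤ δ + ∑ _t : ι, δ := by
        refine add_le_add (hα j) (Finset.sum_le_sum fun t _ => ?_)
        rw [abs_mul, abs_sub_comm]
        calc |A i (c t) - (α ᵥ* A.submatrix r id) (c t)| *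
              |((A.submatrix r c)⁻¹ * A.submatrix r id) t j| ≤ δ * 1 :=
              mul_le_mul (hα (c t)) (hdom t) (abs_nonneg _) hδ0
          _ = δ := mul_one δ
    _ = (Fintype.card ι + 1) * δ := by
        rw [Finset.sum_const, Finset.card_univ, nsmul_eq_mul]; ring

end Ordered

/-! ## The corner entry of `Â⁻¹` is the inverse error -/

section Field

variable {K : Type*} [Field K] {m n : Type*} {k : ℕ}

/-- [cite: GoreinovTyrtyshnikov2001, Thm 2.1 (proof)] THE CORNER ENTRY OF `Â⁻¹` IS `γ⁻¹`: for a
nonsingular pivot block `P = A[r, c]`, the entry of `Â⁻¹`, `Â = A[(i, r), (j, c)]`, in the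
position of the bordering row and column equals `((A - Ã) i j)⁻¹` — the equality case of
`‖Â⁻¹‖_C = |γ⁻¹|`.  (Both sides are `0` when `(A - Ã) i j = 0`, i.e. when `Â` is singular.) -/
theorem inv_submatrix_vecCons_vecCons_apply_zero_zero (A : Matrix m n K) (r : Fin k → m)
    (c : Fin k → n) (hP : IsUnit (A.submatrix r c).det) (i : m) (j : n) :
    (A.submatrix (vecCons i r) (vecCons j c))⁻¹ 0 0 = ((A - crossInterp A r c) i j)⁻¹ := by
  have hdet := det_submatrix_vecCons_vecCons A r c hP i j
  by_cases hE : (A - crossInterp A r c) i j = 0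
  · have hB : ¬ IsUnit (A.submatrix (vecCons i r) (vecCons j c)).det := by
      rw [hdet, hE, mul_zero]; exact not_isUnit_zero
    rw [nonsing_inv_apply_not_isUnit _ hB, hE, _root_.inv_zero, Matrix.zero_apply]
  · have hB : IsUnit (A.submatrix (vecCons i r) (vecCons j c)).det := by
      rw [hdet]; exact hP.mul (Ne.isUnit hE)
    apply eq_inv_of_mul_eq_one_left
    have h := inv_apply_mul_det _ hB (0 : Fin (k + 1)) 0
    rw [adjugate_submatrix_vecCons_vecCons_zero_zero, hdet, ← mul_assoc, mul_comm _ (A.submatrix r c).det,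
      mul_assoc] at h
    exact mul_left_cancel₀ hP.ne_zero (h.trans (mul_one _).symm)

end Field

/-! ## Chebyshev-norm quasi-optimality of maximal-volume cross interpolation -/

section OrderedField

variable {K : Type*} [Field K] [LinearOrder K] [IsStrictOrderedRing K]
variable {m n ι : Type*} [Fintype n] [Fintype ι] [DecidableEq ι] {k : ℕ}

/-- [cite: GoreinovTyrtyshnikov2011]; [cite: Savostyanov2014, §2 eq. (6)];
[cite: GoreinovTyrtyshnikov2001, Thm 2.2]
QUASI-OPTIMALITY IN THE CHEBYSHEV NORM, pivots as a `Fin k`-list and with the volume relaxation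
factor `ν`: if `P = A[r, c]` is a nonsingular `k × k` submatrix with
`ν |det A[r', c']| ≤ |det P|` for every `k × k` submatrix `A[r', c']` of `A` (`0 < ν`; `ν = 1`
is maximal volume), then for every matrix `F` of rank `≤ k` with `|A i j - F i j| ≤ δ`
entrywise, the cross interpolation `Ã = A[:, c] P⁻¹ A[r, :]` satisfies
`|(A - Ã) i j| ≤ ν⁻¹ (k+1)² δ` entrywise, i.e. `‖A - Ã‖_C ≤ ν⁻¹ (k+1)² min_{rank F ≤ k} ‖A - F‖_C`.
SVD-free proof: a kernel vector `x ≠ 0` of the `(k+1) × (k+1)` block `F̂ = F[(i, r), (j, c)]`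
satisfies `x = Â⁻¹ (Â - F̂) x`, and `‖Â⁻¹‖_C ≤ ν⁻¹ |(A - Ã) i j|⁻¹`
(`mul_abs_inv_submatrix_vecCons_vecCons_mul_abs_le_one`). -/
theorem abs_sub_crossInterp_le_of_volume_submaximal_fin (A : Matrix m n K) (r : Fin k → m)
    (c : Fin k → n) (hP : IsUnit (A.submatrix r c).det) {ν : K} (hν : 0 < ν)
    (hmax : ∀ (r' : Fin k → m) (c' : Fin k → n),
      ν * |(A.submatrix r' c').det| ≤ |(A.submatrix r c).det|)
    (F : Matrix m n K) (hF : F.rank ≤ k) {δ : K} (hδ : ∀ i j, |A i j - F i j| ≤ δ)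
    (i : m) (j : n) :
    |(A - crossInterp A r c) i j| ≤ ν⁻¹ * ((k + 1 : K) ^ 2 * δ) := by
  have hδ0 : 0 ≤ δ := (abs_nonneg _).trans (hδ i j)
  -- the `(k+1) × (k+1)` block of `F` is singular
  have hFdet : (F.submatrix (vecCons i r) (vecCons j c)).det = 0 := by
    by_contra h
    have h1 := card_le_rank_of_isUnit_det_submatrix F (r := vecCons i r) (c := vecCons j c)
      (Ne.isUnit h)
    rw [Fintype.card_fin] at h1
    omega
  obtain ⟨x, hx0, hFx⟩ := Matrix.exists_mulVec_eq_zero_iff.mpr hFdet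
  by_cases hE : (A - crossInterp A r c) i j = 0
  · rw [hE, abs_zero]; positivity
  -- `Â` is nonsingular
  have hBunit : IsUnit (A.submatrix (vecCons i r) (vecCons j c)).det := by
    rw [det_submatrix_vecCons_vecCons A r c hP i j]; exact hP.mul (Ne.isUnit hE)
  -- `x = Â⁻¹ ((Â - F̂) x)`
  have hx : x = (A.submatrix (vecCons i r) (vecCons j c))⁻¹ *ᵥ
      ((A.submatrix (vecCons i r) (vecCons j c) - F.submatrix (vecCons i r) (vecCons j c)) *ᵥ x) := by
    rw [sub_mulVec, hFx, sub_zero, mulVec_mulVec, nonsing_inv_mul _ hBunit, one_mulVec]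
  -- a component of `x` of maximal modulus
  obtain ⟨p, -, hp⟩ := Finset.exists_max_image Finset.univ (fun q => |x q|) Finset.univ_nonempty
  have hxp : 0 < |x p| := by
    obtain ⟨q, hq⟩ := Function.ne_iff.mp hx0
    exact (abs_pos.mpr hq).trans_le (hp q (Finset.mem_univ q))
  -- `‖Â⁻¹‖_C` against the error entry
  have hinv : ν * |(A - crossInterp A r c) i j| *
      ∑ q, |(A.submatrix (vecCons i r) (vecCons j c))⁻¹ p q| ≤ (k + 1 : K) := by
    rw [Finset.mul_sum]
    calc ∑ q, ν * |(A - crossInterp A r c) i j| * |(A.submatrix (vecCons i r) (vecCons j c))⁻¹ p q|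
        ≤ ∑ _q : Fin (k + 1), (1 : K) := Finset.sum_le_sum fun q _ => by
          rw [mul_right_comm]
          exact mul_abs_inv_submatrix_vecCons_vecCons_mul_abs_le_one A r c hP hmax i j p q
      _ = (k + 1 : K) := by simp
  -- the sup-norm estimate for `x = Â⁻¹ (Â - F̂) x`
  have key0 : |x p| ≤ (∑ q, |(A.submatrix (vecCons i r) (vecCons j c))⁻¹ p q|) *
      ((k + 1 : K) * δ * |x p|) := by
    have hxpeq : x p = ∑ q, (A.submatrix (vecCons i r) (vecCons j c))⁻¹ p q *
        ∑ t, (A.submatrix (vecCons i r) (vecCons j c) -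
          F.submatrix (vecCons i r) (vecCons j c)) q t * x t := by
      conv_lhs => rw [hx]
      simp [mulVec, dotProduct]
    calc |x p| = |∑ q, (A.submatrix (vecCons i r) (vecCons j c))⁻¹ p q *
          ∑ t, (A.submatrix (vecCons i r) (vecCons j c) -
            F.submatrix (vecCons i r) (vecCons j c)) q t * x t| := by rw [hxpeq]
      _ ≤ ∑ q, |(A.submatrix (vecCons i r) (vecCons j c))⁻¹ p q| *
          ∑ t, |(A.submatrix (vecCons i r) (vecCons j c) -
            F.submatrix (vecCons i r) (vecCons j c)) q t| * |x t| := by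
        refine (Finset.abs_sum_le_sum_abs _ _).trans (Finset.sum_le_sum fun q _ => ?_)
        rw [abs_mul]
        refine mul_le_mul_of_nonneg_left ?_ (abs_nonneg _)
        exact (Finset.abs_sum_le_sum_abs _ _).trans
          (le_of_eq (Finset.sum_congr rfl fun t _ => abs_mul _ _))
      _ ≤ ∑ q, |(A.submatrix (vecCons i r) (vecCons j c))⁻¹ p q| *
          ∑ t, δ * |x p| := by
        refine Finset.sum_le_sum fun q _ => mul_le_mul_of_nonneg_left
          (Finset.sum_le_sum fun t _ => ?_) (abs_nonneg _)
        exact mul_le_mul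
          (by rw [Matrix.sub_apply, submatrix_apply, submatrix_apply]; exact hδ _ _)
          (hp t (Finset.mem_univ t)) (abs_nonneg _) hδ0
      _ = (∑ q, |(A.submatrix (vecCons i r) (vecCons j c))⁻¹ p q|) *
          ((k + 1 : K) * δ * |x p|) := by
        rw [Finset.sum_mul]
        refine Finset.sum_congr rfl fun q _ => ?_
        rw [Finset.sum_const, Finset.card_univ, Fintype.card_fin, nsmul_eq_mul]
        push_cast; ring
  have key : |x p| * (ν * |(A - crossInterp A r c) i j|) ≤ |x p| * ((k + 1 : K) ^ 2 * δ) := by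
    calc |x p| * (ν * |(A - crossInterp A r c) i j|)
        ≤ (∑ q, |(A.submatrix (vecCons i r) (vecCons j c))⁻¹ p q|) *
            ((k + 1 : K) * δ * |x p|) * (ν * |(A - crossInterp A r c) i j|) :=
          mul_le_mul_of_nonneg_right key0 (by positivity)
      _ = (ν * |(A - crossInterp A r c) i j| *
            ∑ q, |(A.submatrix (vecCons i r) (vecCons j c))⁻¹ p q|) *
            ((k + 1 : K) * δ * |x p|) := by ring
      _ ≤ (k + 1 : K) * ((k + 1 : K) * δ * |x p|) :=
          mul_le_mul_of_nonneg_right hinv (by positivity)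
      _ = |x p| * ((k + 1 : K) ^ 2 * δ) := by ring
  have hνE : ν * |(A - crossInterp A r c) i j| ≤ (k + 1 : K) ^ 2 * δ :=
    le_of_mul_le_mul_left key hxp
  calc |(A - crossInterp A r c) i j| = ν⁻¹ * (ν * |(A - crossInterp A r c) i j|) := by
        rw [← mul_assoc, inv_mul_cancel₀ hν.ne', one_mul]
    _ ≤ ν⁻¹ * ((k + 1 : K) ^ 2 * δ) := mul_le_mul_of_nonneg_left hνE (inv_nonneg.mpr hν.le)

/-- [cite: GoreinovTyrtyshnikov2011]; [cite: Savostyanov2014, §2 eq. (6)]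
QUASI-OPTIMALITY OF MAXIMAL-VOLUME CROSS (SKELETON) INTERPOLATION IN THE CHEBYSHEV NORM:
if the `r × r` pivot block `P = A[I, J]` (`r = #ι`) is nonsingular and has maximal volume
`|det P|` among all `r × r` submatrices of `A`, then the cross interpolation
`Ã = A[:, J] P⁻¹ A[I, :]` satisfies `‖A - Ã‖_C ≤ (r+1)² min_{rank F ≤ r} ‖A - F‖_C`
(`‖·‖_C` = largest entry in modulus), stated entrywise: for every `F` of rank `≤ r` with
`|A i j - F i j| ≤ δ` for all `i, j`, `|(A - Ã) i j| ≤ (r+1)² δ` for all `i, j`.  As reported in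
[Savostyanov2014, §2 eq. (6)] (there attributed to Schneider 2010 and to
[GoreinovTyrtyshnikov2011]); the proof given here is an elementary determinant argument.  The companion spectral-norm bound
`‖A - Ã‖_C ≤ (r+1) σ_{r+1}(A)` of [GoreinovTyrtyshnikov2001, Thm 2.1 / Cor. 2.3] is NOT
formalised here (no singular values); its determinant half is
`mul_abs_inv_submatrix_vecCons_vecCons_mul_abs_le_one`. -/
theorem abs_sub_crossInterp_le_of_volume_maximal (A : Matrix m n K) (r : ι → m) (c : ι → n)
    (hP : IsUnit (A.submatrix r c).det)
    (hmax : ∀ (r' : ι → m) (c' : ι → n), |(A.submatrix r' c').det| ≤ |(A.submatrix r c).det|)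
    (F : Matrix m n K) (hF : F.rank ≤ Fintype.card ι) {δ : K} (hδ : ∀ i j, |A i j - F i j| ≤ δ)
    (i : m) (j : n) :
    |(A - crossInterp A r c) i j| ≤ (Fintype.card ι + 1 : K) ^ 2 * δ := by
  set e : Fin (Fintype.card ι) ≃ ι := (Fintype.equivFin ι).symm with he
  have hsub : ∀ (r' : ι → m) (c' : ι → n),
      (A.submatrix (r' ∘ e) (c' ∘ e)).det = (A.submatrix r' c').det := fun r' c' => by
    rw [show A.submatrix (r' ∘ ⇑e) (c' ∘ ⇑e) = (A.submatrix r' c').submatrix e e from rfl,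
      det_submatrix_equiv_self]
  have hP' : IsUnit (A.submatrix (r ∘ e) (c ∘ e)).det := by rwa [hsub]
  have hmax' : ∀ (r' : Fin (Fintype.card ι) → m) (c' : Fin (Fintype.card ι) → n),
      1 * |(A.submatrix r' c').det| ≤ |(A.submatrix (r ∘ e) (c ∘ e)).det| := fun r' c' => by
    rw [one_mul, hsub r c]
    have h2 := hmax (r' ∘ e.symm) (c' ∘ e.symm)
    rw [← hsub] at h2
    simpa only [Function.comp_assoc, Equiv.symm_comp_self, Function.comp_id] using h2
  have h := abs_sub_crossInterp_le_of_volume_submaximal_fin A (r ∘ e) (c ∘ e) hP' one_pos hmax'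
    F hF hδ i j
  rwa [crossInterp_comp_equiv, inv_one, one_mul] at h

end OrderedField

end Literature.LinearAlgebra.Matrix
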